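import Mathlib
import HarnessLib
import Summits.HubbardSuperconductivity.HubbardSuperconductivity.Theorems.KLProgrammeKLRegimeEnginePairTransferOutClassAssemblyG14
import Summits.HubbardSuperconductivity.HubbardSuperconductivity.Theorems.KLProgrammeKLRegimeSplitFlatCubicSum

/-!
# Route `KLProgramme` — ENGINE item stmt-HubbardSuperconductivity-20437 `KLRegimeEngineV17F2`, stub (c) value lane, AMENDMENT 25 «(X).3-KLTS-CAP»:
# THE CAPPED BAR'S EREM RESIDUE BOOKS AT THE `Q`-FLOOR OF RECORD UNDER ONE `U`-SMALLNESS — no `Q`-side `klTS` key (cell gate-hubbard-kl, seat hubbard-kl-k3c2-p2 g21)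

THE POINT.  Under the `klTS`-keyed cap `0 ≤ r ≤ 2²⁰(1+klTS)` ((R257) shape (a); `klTS` opaque) the class-#5 bar's non-gain residue
`E₂(r) = 2r·15367·(KlamU)²/L + 4r·15367·(Klam|U|)³·2^{−(n+1)}` no longer fits `½·eremBar` through `relBar_klCT7_shares_half`'s CR/CL comparisons at the
`Q`-floor of record (`2⁶⁰Psq²Rsq² ≤ Q.CR`, `2⁶⁰Psq²Rsq²(β²+1)4ⁿ ≤ Q.CL β n`): the cubic/cubic comparison `2r·15367 ≤ a·Q.CR` is `U`-free, so (R257) booked a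
Q-SIDE `(1+klTS)` key on `Q.CR`/`Q.CL` — which re-keys the `Q` table, every `hQCR : Q.CR = (klEngQ5 P R).CR` closer and the `U₀4` smallness line.
THIS FILE REMOVES THAT NEED: the engine packages have `cloc = 2¹⁰`, `θ = ½` (`klEngGeo11/13/14`), so the localisation slot `cloc·(KlamU)²·4^{−θn} = 2¹⁰(KlamU)²·2⁻ⁿ` has
the SAME profile as the cubic slot, and in the `hout` chain its share is only half used (step (i) takes `2s = ½`; `E₂`'s booking takes none).  Splitting
`r = r₀ + r₁`, `r₀ ≤ 2²⁰`, `r₁ ≤ 2²⁰klTS`: the unkeyed part books as before (`¼` of CR, `¼` of CL), the keyed cubic `2²¹·15367·klTS·(Klam|U|)³·2⁻ⁿ =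
[2²¹·15367·klTS·Klam|U|]·(KlamU)²·2⁻ⁿ` books in `½·cloc·(KlamU)²·2⁻ⁿ` and the keyed `1/L` part in the CL slack, BOTH under the single `U`-smallness
**`2²⁶·klTS·Klam·|U| ≤ 1`** — a threshold the class-#5 package's OWN `u`-slot (`klCTu7/8 P R …`, a `klEngU₀12` min-entry that sees `P` and `klTS`) can carry in the
same (X).3 re-render, with the `Q`-floor, `hQCR` and `U₀4` UNCHANGED.
* §1 `klEngGeo11_cloc_eq` (`= 2¹⁰`), `klEngGeo11_θ_eq` (`= ½`), `rpow_four_neg_half_mul`, `cloc_slot_eq_of_half` (the slot's `2⁻ⁿ` form);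
* §2 **`relBar_cap_residue_le_half_eremBar_of_U`** (generic `G` with `θ = ½`, `2¹⁰ ≤ cloc`) and its instances `…_klEngGeo11/14`: `E₂(r) ≤ ½·eremBar G P Q U β L n`;
  `hout_hE_cap_of_U` — the `hE` binder of `outClass_hout_klEngGeo13(_alpha/_of_raw)` / `…_le_bars_klEngGeo14_of_shares` at `s = ¼` under the cap;
* §3 WITH THE FLAT CUBIC (door (ii)): `relBar_cap_residue_flat_le_half_host_of_U` — `E₂(r) + 2r·15367·c₃(Klam|U|)³ ≤ ½·(eremBar + (2 ^ 36 * (1 + klTS) * c₃ * (P.Klam * |U|) ^ 3))` with the additive host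
  `(2 ^ 36 * (1 + klTS) * c₃ * (P.Klam * |U|) ^ 3) := 2³⁶(1+klTS)·c₃·(Klam|U|)³` (the `(1+klTS)` is INHERENT: the flat term's prefactor is the capped `r`), `hout_hE_cap_flat_of_U`, and the host's
  LADDER SUM `sum_flatHost_range_le` (`≤ 2³⁶(1+klTS)c₃·Klam³·|U|·(cc/log4 + U²)`, `flat_cubic_sum_range_le` p660610) — the one `cc`-keyed entry door (ii) costs.
Real arithmetic over landed lemmas; nothing about the model is asserted; nothing asserts (E2″-F), (c), K3 or superconductivity.  0 kit · 0 lit.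
-/

noncomputable section

namespace Summit.HubbardSuperconductivity.HubbardSuperconductivity.Theorems.EngineV8

set_option linter.dupNamespace false -- summit = problem name (single-conjunct summit), D-0017

open Real Finset Literature.MathematicalPhysics.QuantumLattice Literature.Probability.LatticeModels
open Summit.HubbardSuperconductivity.HubbardSuperconductivity.Theorems.KLRegimeSplit
open Summit.HubbardSuperconductivity.HubbardSuperconductivity.Theorems.KLProgrammeLegKernels
open Summit.HubbardSuperconductivity.HubbardSuperconductivity.Theorems.DispersionFlow

/-! ## §1 The localisation slot of the engine packages has the cubic slot's profile -/

/-- `klEngGeo11.cloc = 2¹⁰` (untouched since `klEngGeo`). -/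
theorem klEngGeo11_cloc_eq : klEngGeo11.cloc = 2 ^ 10 := rfl

/-- `klEngGeo11.θ = ½` (untouched since `klEngGeo`). -/
theorem klEngGeo11_θ_eq : klEngGeo11.θ = 1 / 2 := rfl

/-- `klEngGeo14.cloc = 2¹⁰`. -/
theorem klEngGeo14_cloc_eq : klEngGeo14.cloc = 2 ^ 10 := rfl

/-- `klEngGeo14.θ = ½`. -/
theorem klEngGeo14_θ_eq : klEngGeo14.θ = 1 / 2 := rfl

/-- `4^{−(n/2)} = 2⁻ⁿ`. -/
theorem rpow_four_neg_half_mul (n : ℕ) : (4 : ℝ) ^ (-((1 : ℝ) / 2 * n)) = ((2 : ℝ) ^ n)⁻¹ := by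
  rw [Real.rpow_neg (by norm_num), show (4 : ℝ) = 2 ^ (2 : ℝ) by norm_num, ← Real.rpow_mul (by norm_num),
    show (2 : ℝ) * (1 / 2 * n) = n by ring, Real.rpow_natCast]

/-- **The localisation slot at rate `θ = ½` is `cloc·(KlamU)²·2⁻ⁿ`.** -/
theorem cloc_slot_eq_of_half {G : GeoConsts} (hθ : G.θ = 1 / 2) (P : SplitConsts) (U : ℝ) (n : ℕ) :
    G.cloc * (P.Klam * U) ^ 2 * (4 : ℝ) ^ (-(G.θ * n)) = G.cloc * (P.Klam * U) ^ 2 * ((2 : ℝ) ^ n)⁻¹ := by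
  rw [hθ, rpow_four_neg_half_mul]

/-! ## §2 The capped residue at the `Q`-floor of record under `2²⁶·klTS·Klam·|U| ≤ 1` -/

/-- **The arithmetic core** (atoms: `T = klTS`, `X = Klam|U|`, `K2 = (KlamU)² = X²`, `D = 2⁻ⁿ`, `IL = 1/L`): under `r ≤ 2²⁰(1+T)`, `X ≤ 1`, `2²⁶·T·X ≤ 1`,
`2¹⁰ ≤ cloc`, `2⁶⁰ ≤ CR`, `2⁶⁰ ≤ CL`: `2r·15367·(K2·IL) + 4r·15367·(X·K2·(½D)) ≤ ½·(cloc·K2·D + CR·(X·K2)·D + CL·IL)`. -/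
theorem cap_residue_arith {r T X K2 D IL cloc CR CL : ℝ} (hT : 0 ≤ T) (hX0 : 0 ≤ X) (hX1 : X ≤ 1) (hK2 : K2 = X ^ 2) (hD : 0 ≤ D) (hIL : 0 ≤ IL)
    (hr : 0 ≤ r) (hrc : r ≤ 2 ^ 20 * (1 + T)) (hTX : 2 ^ 26 * T * X ≤ 1) (hcloc : 2 ^ 10 ≤ cloc) (hCR : 2 ^ 60 ≤ CR) (hCL : 2 ^ 60 ≤ CL) :
    2 * r * 15367 * (K2 * IL) + 4 * r * 15367 * (X * K2 * (2⁻¹ * D)) ≤ 2⁻¹ * (cloc * K2 * D + CR * (X * K2) * D + CL * IL) := by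
  have hK20 : 0 ≤ K2 := by rw [hK2]; positivity
  have hK21 : K2 ≤ 1 := by rw [hK2]; nlinarith
  -- prefactor: `2r·15367 ≤ 2³⁵(1+T)`
  have hpre : 2 * r * 15367 ≤ 2 ^ 35 * (1 + T) := by
    have h1 : 2 * r * 15367 ≤ 2 * (2 ^ 20 * (1 + T)) * 15367 := by nlinarith
    nlinarith
  have hpre0 : 0 ≤ 2 * r * 15367 := by positivity
  -- `2³⁵·T·X ≤ 2⁹`, `T·K2 ≤ T·X`
  have hTX9 : 2 ^ 35 * T * X ≤ 2 ^ 9 := by linarith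
  have hTK2 : T * K2 ≤ T * X := by
    rw [hK2, sq, ← mul_assoc]
    exact mul_le_of_le_one_right (mul_nonneg hT hX0) hX1
  -- (A) the `1/L` part
  have hA1 : 2 * r * 15367 * K2 ≤ 2 ^ 35 * (1 + T) * K2 := mul_le_mul_of_nonneg_right hpre hK20
  have hA2 : 2 ^ 35 * (1 + T) * K2 ≤ 2 ^ 35 + 2 ^ 9 := by
    have : 2 ^ 35 * (1 + T) * K2 = 2 ^ 35 * K2 + 2 ^ 35 * (T * K2) := by ring
    rw [this]
    have h1 : 2 ^ 35 * K2 ≤ (2 : ℝ) ^ 35 := by nlinarith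
    have h2 : 2 ^ 35 * (T * K2) ≤ (2 : ℝ) ^ 9 := by nlinarith
    linarith
  have hA3 : (2 : ℝ) ^ 35 + 2 ^ 9 ≤ 2⁻¹ * CL := by linarith
  have hA : 2 * r * 15367 * (K2 * IL) ≤ 2⁻¹ * (CL * IL) := by
    have h := mul_le_mul_of_nonneg_right ((hA1.trans hA2).trans hA3) hIL
    calc 2 * r * 15367 * (K2 * IL) = 2 * r * 15367 * K2 * IL := by ring
      _ ≤ 2⁻¹ * CL * IL := h
      _ = 2⁻¹ * (CL * IL) := by ring
  -- (B) the cubic part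
  have hXKD : 0 ≤ X * (K2 * D) := by positivity
  have hKD : 0 ≤ K2 * D := by positivity
  have hB1 : 2 * r * 15367 * (X * (K2 * D)) ≤ 2 ^ 35 * (1 + T) * (X * (K2 * D)) := mul_le_mul_of_nonneg_right hpre hXKD
  have hB2 : 2 ^ 35 * (1 + T) * (X * (K2 * D)) = 2 ^ 35 * (X * (K2 * D)) + (2 ^ 35 * T * X) * (K2 * D) := by ring
  have hB3 : (2 ^ 35 * T * X) * (K2 * D) ≤ 2 ^ 9 * (K2 * D) := mul_le_mul_of_nonneg_right hTX9 hKD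
  have hB4 : 2 ^ 9 * (K2 * D) ≤ 2⁻¹ * (cloc * K2 * D) := by
    have : (2 : ℝ) ^ 9 ≤ 2⁻¹ * cloc := by linarith
    have h := mul_le_mul_of_nonneg_right this hKD
    calc 2 ^ 9 * (K2 * D) ≤ 2⁻¹ * cloc * (K2 * D) := h
      _ = 2⁻¹ * (cloc * K2 * D) := by ring
  have hB5 : 2 ^ 35 * (X * (K2 * D)) ≤ 2⁻¹ * (CR * (X * K2) * D) := by
    have : (2 : ℝ) ^ 35 ≤ 2⁻¹ * CR := by linarith
    have h := mul_le_mul_of_nonneg_right this hXKD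
    calc 2 ^ 35 * (X * (K2 * D)) ≤ 2⁻¹ * CR * (X * (K2 * D)) := h
      _ = 2⁻¹ * (CR * (X * K2) * D) := by ring
  have hB : 4 * r * 15367 * (X * K2 * (2⁻¹ * D)) ≤ 2⁻¹ * (cloc * K2 * D) + 2⁻¹ * (CR * (X * K2) * D) := by
    have e : 4 * r * 15367 * (X * K2 * (2⁻¹ * D)) = 2 * r * 15367 * (X * (K2 * D)) := by ring
    rw [e]; linarith
  have e1 : 2⁻¹ * (cloc * K2 * D + CR * (X * K2) * D + CL * IL) = 2⁻¹ * (cloc * K2 * D) + 2⁻¹ * (CR * (X * K2) * D) + 2⁻¹ * (CL * IL) := by ring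
  rw [e1]; linarith

/-- **THE CAPPED BAR'S RESIDUE FITS HALF THE EREM BAR OF RECORD** (module docstring): `G` with `θ = ½`, `2¹⁰ ≤ cloc`; `0 ≤ r ≤ 2²⁰(1+klTS)`; `0 ≤ Klam`,
`(KlamU)² ≤ 1`, **`2²⁶·klTS·Klam·|U| ≤ 1`**; the `Q`-floor of record `2⁶⁰Psq²Rsq² ≤ Q.CR`, `2⁶⁰Psq²Rsq²(β²+1)4ⁿ ≤ Q.CL β n` ⇒
`2r·15367(KlamU)²/L + 4r·15367(Klam|U|)³2^{−(n+1)} ≤ ½·eremBar G P Q U β L n`. -/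
theorem relBar_cap_residue_le_half_eremBar_of_U {G : GeoConsts} (hθ : G.θ = 1 / 2) (hcloc : 2 ^ 10 ≤ G.cloc) {P : SplitConsts} (hKl : 0 ≤ P.Klam)
    (R : RenConsts) (Q : EngConsts) {U β r : ℝ} (L n : ℕ) (hr : 0 ≤ r) (hrc : r ≤ 2 ^ 20 * (1 + klTS)) (hKU : (P.Klam * U) ^ 2 ≤ 1)
    (hTU : 2 ^ 26 * klTS * (P.Klam * |U|) ≤ 1)
    (hQCR : 2 ^ 60 * klEngPsq P ^ 2 * klEngRsq R ^ 2 ≤ Q.CR) (hQCL : 2 ^ 60 * klEngPsq P ^ 2 * klEngRsq R ^ 2 * (β ^ 2 + 1) * (4 : ℝ) ^ n ≤ Q.CL β n) :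
    2 * r * 15367 * ((P.Klam * U) ^ 2 * ((L : ℝ))⁻¹) + 4 * r * 15367 * ((P.Klam * |U|) ^ 3 * ((2 : ℝ) ^ (n + 1))⁻¹) ≤
      2⁻¹ * eremBar G P Q U β L n := by
  unfold eremBar
  rw [cloc_slot_eq_of_half hθ]
  have hX0 : 0 ≤ P.Klam * |U| := mul_nonneg hKl (abs_nonneg U)
  have hK2X : (P.Klam * U) ^ 2 = (P.Klam * |U|) ^ 2 := by rw [mul_pow, mul_pow, sq_abs]
  have hX1 : P.Klam * |U| ≤ 1 := by
    have hX2 : (P.Klam * |U|) ^ 2 ≤ 1 := by rw [← hK2X]; exact hKU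
    nlinarith
  have hX3 : (P.Klam * |U|) ^ 3 = (P.Klam * |U|) * (P.Klam * U) ^ 2 := by rw [hK2X]; ring
  have hsucc : ((2 : ℝ) ^ (n + 1))⁻¹ = 2⁻¹ * ((2 : ℝ) ^ n)⁻¹ := by rw [pow_succ, mul_inv, mul_comm]
  -- floors
  have hP := one_le_klEngPsq P
  have hRq := one_le_klEngRsq R
  have hPR : 1 ≤ klEngPsq P ^ 2 * klEngRsq R ^ 2 := by nlinarith [one_le_pow₀ (n := 2) hP, one_le_pow₀ (n := 2) hRq]
  have h60 : (2 : ℝ) ^ 60 ≤ Q.CR := by nlinarith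
  have hb : (1 : ℝ) ≤ (β ^ 2 + 1) * (4 : ℝ) ^ n := by nlinarith [sq_nonneg β, one_le_pow₀ (n := n) (by norm_num : (1 : ℝ) ≤ 4)]
  have h60' : (2 : ℝ) ^ 60 ≤ Q.CL β n := by
    have : (2 : ℝ) ^ 60 * klEngPsq P ^ 2 * klEngRsq R ^ 2 ≤ 2 ^ 60 * klEngPsq P ^ 2 * klEngRsq R ^ 2 * ((β ^ 2 + 1) * (4 : ℝ) ^ n) :=
      le_mul_of_one_le_right (by positivity) hb
    nlinarith
  have h := cap_residue_arith (r := r) (cloc := G.cloc) (CR := Q.CR) (CL := Q.CL β n) (D := ((2 : ℝ) ^ n)⁻¹) (IL := ((L : ℝ))⁻¹)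
    klTS_nonneg hX0 hX1 hK2X (by positivity) (by positivity) hr hrc hTU hcloc h60 h60'
  rw [hX3, hsucc, div_eq_mul_inv]
  linarith

/-- **Instance at `klEngGeo11`** (the erem slot of `outClass_hout_klEngGeo13(_alpha/_of_raw)`'s `hE`). -/
theorem relBar_cap_residue_le_half_eremBar_klEngGeo11_of_U {P : SplitConsts} (hKl : 0 ≤ P.Klam) (R : RenConsts) (Q : EngConsts) {U β r : ℝ} (L n : ℕ)
    (hr : 0 ≤ r) (hrc : r ≤ 2 ^ 20 * (1 + klTS)) (hKU : (P.Klam * U) ^ 2 ≤ 1) (hTU : 2 ^ 26 * klTS * (P.Klam * |U|) ≤ 1)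
    (hQCR : 2 ^ 60 * klEngPsq P ^ 2 * klEngRsq R ^ 2 ≤ Q.CR) (hQCL : 2 ^ 60 * klEngPsq P ^ 2 * klEngRsq R ^ 2 * (β ^ 2 + 1) * (4 : ℝ) ^ n ≤ Q.CL β n) :
    2 * r * 15367 * ((P.Klam * U) ^ 2 * ((L : ℝ))⁻¹) + 4 * r * 15367 * ((P.Klam * |U|) ^ 3 * ((2 : ℝ) ^ (n + 1))⁻¹) ≤
      2⁻¹ * eremBar klEngGeo11 P Q U β L n :=
  relBar_cap_residue_le_half_eremBar_of_U klEngGeo11_θ_eq (le_of_eq klEngGeo11_cloc_eq.symm) hKl R Q L n hr hrc hKU hTU hQCR hQCL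

/-- **Instance at `klEngGeo14`.** -/
theorem relBar_cap_residue_le_half_eremBar_klEngGeo14_of_U {P : SplitConsts} (hKl : 0 ≤ P.Klam) (R : RenConsts) (Q : EngConsts) {U β r : ℝ} (L n : ℕ)
    (hr : 0 ≤ r) (hrc : r ≤ 2 ^ 20 * (1 + klTS)) (hKU : (P.Klam * U) ^ 2 ≤ 1) (hTU : 2 ^ 26 * klTS * (P.Klam * |U|) ≤ 1)
    (hQCR : 2 ^ 60 * klEngPsq P ^ 2 * klEngRsq R ^ 2 ≤ Q.CR) (hQCL : 2 ^ 60 * klEngPsq P ^ 2 * klEngRsq R ^ 2 * (β ^ 2 + 1) * (4 : ℝ) ^ n ≤ Q.CL β n) :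
    2 * r * 15367 * ((P.Klam * U) ^ 2 * ((L : ℝ))⁻¹) + 4 * r * 15367 * ((P.Klam * |U|) ^ 3 * ((2 : ℝ) ^ (n + 1))⁻¹) ≤
      2⁻¹ * eremBar klEngGeo14 P Q U β L n :=
  relBar_cap_residue_le_half_eremBar_of_U klEngGeo14_θ_eq (le_of_eq klEngGeo14_cloc_eq.symm) hKl R Q L n hr hrc hKU hTU hQCR hQCL

/-- **THE `hE` BINDER UNDER THE CAP, `Q`-floor of record** (`s = ¼`, erem literal at `klEngGeo11`): `2·¼·erem + E₂(r) ≤ erem`. -/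
theorem hout_hE_cap_of_U {P : SplitConsts} (hP : P.WF) (R : RenConsts) {Q : EngConsts} (hQ : Q.WF) {U β r : ℝ} (L n : ℕ)
    (hr : 0 ≤ r) (hrc : r ≤ 2 ^ 20 * (1 + klTS)) (hKU : (P.Klam * U) ^ 2 ≤ 1) (hTU : 2 ^ 26 * klTS * (P.Klam * |U|) ≤ 1)
    (hQCR : 2 ^ 60 * klEngPsq P ^ 2 * klEngRsq R ^ 2 ≤ Q.CR) (hQCL : 2 ^ 60 * klEngPsq P ^ 2 * klEngRsq R ^ 2 * (β ^ 2 + 1) * (4 : ℝ) ^ n ≤ Q.CL β n) :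
    2 * 4⁻¹ * eremBar klEngGeo11 P Q U β L n +
        (2 * r * 15367 * ((P.Klam * U) ^ 2 * ((L : ℝ))⁻¹) + 4 * r * 15367 * ((P.Klam * |U|) ^ 3 * ((2 : ℝ) ^ (n + 1))⁻¹)) ≤
      eremBar klEngGeo11 P Q U β L n := by
  have h := relBar_cap_residue_le_half_eremBar_klEngGeo11_of_U (zero_le_one.trans hP.1) R Q L n hr hrc hKU hTU hQCR hQCL
  have h0 : 0 ≤ eremBar klEngGeo11 P Q U β L n := eremBar_nonneg' klEngGeo11_wf hP hQ U β L n
  linarith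

/-! ## §3 With the flat cubic of door (ii): the additive host and its ladder sum -/

/-- **The flat host `2³⁶·(1+klTS)·c₃·(Klam|U|)³` is non-negative** (`0 ≤ c₃`, `0 ≤ Klam`).  (The additive erem host of the capped bar's flat cubic
`2r·15367·c₃·(Klam|U|)³` at share `½`; the `(1+klTS)` is the cap's; `c₃` = door (ii)'s closed constant `klC3` once class #1/(c) fix `λ̄, ℓ_W, e_W`; written
LITERALLY everywhere — no definition, the pen names it.) -/
theorem flatHost_nonneg {c₃ : ℝ} (hc : 0 ≤ c₃) (U : ℝ) {P : SplitConsts} (hKl : 0 ≤ P.Klam) : 0 ≤ 2 ^ 36 * (1 + klTS) * c₃ * (P.Klam * |U|) ^ 3 := by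
  have := klTS_nonneg
  have : 0 ≤ P.Klam * |U| := mul_nonneg hKl (abs_nonneg U)
  positivity

/-- The flat term books in half the host: `2r·15367·(c₃(Klam|U|)³) ≤ ½·(2 ^ 36 * (1 + klTS) * c₃ * (P.Klam * |U|) ^ 3)` (`r ≤ 2²⁰(1+klTS)`, `0 ≤ c₃`, `0 ≤ Klam`). -/
theorem flat_le_half_flatHost {c₃ : ℝ} (hc : 0 ≤ c₃) {P : SplitConsts} (hKl : 0 ≤ P.Klam) (U : ℝ) {r : ℝ} (hrc : r ≤ 2 ^ 20 * (1 + klTS)) :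
    2 * r * 15367 * (c₃ * (P.Klam * |U|) ^ 3) ≤ 2⁻¹ * (2 ^ 36 * (1 + klTS) * c₃ * (P.Klam * |U|) ^ 3) := by
  have hT := klTS_nonneg
  have h3 : 0 ≤ c₃ * (P.Klam * |U|) ^ 3 := by have := mul_nonneg hKl (abs_nonneg U); positivity
  have hpre : 2 * r * 15367 ≤ 2⁻¹ * (2 ^ 36 * (1 + klTS)) := by nlinarith
  calc 2 * r * 15367 * (c₃ * (P.Klam * |U|) ^ 3) ≤ 2⁻¹ * (2 ^ 36 * (1 + klTS)) * (c₃ * (P.Klam * |U|) ^ 3) := mul_le_mul_of_nonneg_right hpre h3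
    _ = 2⁻¹ * (2 ^ 36 * (1 + klTS) * c₃ * (P.Klam * |U|) ^ 3) := by ring

/-- **THE CAPPED RESIDUE WITH THE FLAT CUBIC FITS HALF OF `eremBar + 2³⁶(1+klTS)c₃(Klam|U|)³`** (door (ii), `Q`-floor of record, one `U`-smallness). -/
theorem relBar_cap_residue_flat_le_half_host_of_U {G : GeoConsts} (hθ : G.θ = 1 / 2) (hcloc : 2 ^ 10 ≤ G.cloc) {P : SplitConsts} (hKl : 0 ≤ P.Klam)
    (R : RenConsts) (Q : EngConsts) {U β r c₃ : ℝ} (hc : 0 ≤ c₃) (L n : ℕ) (hr : 0 ≤ r) (hrc : r ≤ 2 ^ 20 * (1 + klTS)) (hKU : (P.Klam * U) ^ 2 ≤ 1)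
    (hTU : 2 ^ 26 * klTS * (P.Klam * |U|) ≤ 1)
    (hQCR : 2 ^ 60 * klEngPsq P ^ 2 * klEngRsq R ^ 2 ≤ Q.CR) (hQCL : 2 ^ 60 * klEngPsq P ^ 2 * klEngRsq R ^ 2 * (β ^ 2 + 1) * (4 : ℝ) ^ n ≤ Q.CL β n) :
    2 * r * 15367 * ((P.Klam * U) ^ 2 * ((L : ℝ))⁻¹) + 4 * r * 15367 * ((P.Klam * |U|) ^ 3 * ((2 : ℝ) ^ (n + 1))⁻¹) +
        2 * r * 15367 * (c₃ * (P.Klam * |U|) ^ 3) ≤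
      2⁻¹ * (eremBar G P Q U β L n + (2 ^ 36 * (1 + klTS) * c₃ * (P.Klam * |U|) ^ 3)) := by
  have h1 := relBar_cap_residue_le_half_eremBar_of_U hθ hcloc hKl R Q L n hr hrc hKU hTU hQCR hQCL
  have h2 := flat_le_half_flatHost hc hKl U hrc
  linarith

/-- **THE `hE` BINDER WITH THE FLAT CUBIC** (`s = ¼`, erem literal at `klEngGeo11`, host `Ē := eremBar + 2³⁶(1+klTS)c₃(Klam|U|)³`): `2·¼·erem + E₂′(r) ≤ erem + 2³⁶(1+klTS)c₃(Klam|U|)³`. -/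
theorem hout_hE_cap_flat_of_U {P : SplitConsts} (hP : P.WF) (R : RenConsts) {Q : EngConsts} (hQ : Q.WF) {U β r c₃ : ℝ} (hc : 0 ≤ c₃) (L n : ℕ)
    (hr : 0 ≤ r) (hrc : r ≤ 2 ^ 20 * (1 + klTS)) (hKU : (P.Klam * U) ^ 2 ≤ 1) (hTU : 2 ^ 26 * klTS * (P.Klam * |U|) ≤ 1)
    (hQCR : 2 ^ 60 * klEngPsq P ^ 2 * klEngRsq R ^ 2 ≤ Q.CR) (hQCL : 2 ^ 60 * klEngPsq P ^ 2 * klEngRsq R ^ 2 * (β ^ 2 + 1) * (4 : ℝ) ^ n ≤ Q.CL β n) :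
    2 * 4⁻¹ * eremBar klEngGeo11 P Q U β L n +
        (2 * r * 15367 * ((P.Klam * U) ^ 2 * ((L : ℝ))⁻¹) + 4 * r * 15367 * ((P.Klam * |U|) ^ 3 * ((2 : ℝ) ^ (n + 1))⁻¹) +
          2 * r * 15367 * (c₃ * (P.Klam * |U|) ^ 3)) ≤
      eremBar klEngGeo11 P Q U β L n + (2 ^ 36 * (1 + klTS) * c₃ * (P.Klam * |U|) ^ 3) := by
  have h := relBar_cap_residue_flat_le_half_host_of_U klEngGeo11_θ_eq (le_of_eq klEngGeo11_cloc_eq.symm) (zero_le_one.trans hP.1) R Q hc L n hr hrc hKU hTU hQCR hQCL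
  have h0 : 0 ≤ eremBar klEngGeo11 P Q U β L n := eremBar_nonneg' klEngGeo11_wf hP hQ U β L n
  have hF := flatHost_nonneg hc U (zero_le_one.trans hP.1)
  linarith

/-- **THE HOST'S LADDER SUM** (the one `cc`-keyed entry door (ii) costs): for `0 ≤ c₃`, `0 ≤ Klam`, `0 ≤ cc`, `klBetaMin ≤ β ≤ exp(cc/U²)`, `N ≤ n_β + 2`:
`Σ_{n<N} (2 ^ 36 * (1 + klTS) * c₃ * (P.Klam * |U|) ^ 3) ≤ 2³⁶(1+klTS)·c₃·Klam³·|U|·(cc/log 4 + U²)`. -/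
theorem sum_flatHost_range_le {c₃ : ℝ} (hc : 0 ≤ c₃) {P : SplitConsts} (hKl : 0 ≤ P.Klam) {U cc β : ℝ} (hcc : 0 ≤ cc) (hβ : klBetaMin ≤ β)
    (hβc : β ≤ Real.exp (cc / U ^ 2)) {N : ℕ} (hN : N ≤ nScales β + 2) :
    ∑ _n ∈ range N, (2 ^ 36 * (1 + klTS) * c₃ * (P.Klam * |U|) ^ 3) ≤ 2 ^ 36 * (1 + klTS) * c₃ * P.Klam ^ 3 * |U| * (cc / Real.log 4 + U ^ 2) := by
  have hT := klTS_nonneg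
  have hC : 0 ≤ 2 ^ 36 * (1 + klTS) * c₃ := by positivity
  have h := flat_cubic_sum_range_le (C := 2 ^ 36 * (1 + klTS) * c₃) (K := P.Klam) (U := U) hC hKl hcc hβ hβc hN
  refine h.trans (le_of_eq ?_)
  ring

/-- **The same over a window `(t, N]`, `N ≤ n_β + 1`.** -/
theorem sum_flatHost_Ioc_le {c₃ : ℝ} (hc : 0 ≤ c₃) {P : SplitConsts} (hKl : 0 ≤ P.Klam) {U cc β : ℝ} (hcc : 0 ≤ cc) (hβ : klBetaMin ≤ β)
    (hβc : β ≤ Real.exp (cc / U ^ 2)) {t N : ℕ} (hN : N ≤ nScales β + 1) :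
    ∑ _n ∈ Ioc t N, (2 ^ 36 * (1 + klTS) * c₃ * (P.Klam * |U|) ^ 3) ≤ 2 ^ 36 * (1 + klTS) * c₃ * P.Klam ^ 3 * |U| * (cc / Real.log 4 + U ^ 2) := by
  have hT := klTS_nonneg
  have hC : 0 ≤ 2 ^ 36 * (1 + klTS) * c₃ := by positivity
  have h := flat_cubic_sum_Ioc_le (C := 2 ^ 36 * (1 + klTS) * c₃) (K := P.Klam) (U := U) (t := t) hC hKl hcc hβ hβc hN
  refine h.trans (le_of_eq ?_)
  ring

end Summit.HubbardSuperconductivity.HubbardSuperconductivity.Theorems.EngineV8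

end
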